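import Mathlib
import Literature.NumberTheory.LFunctions.ZetaScrew
import HarnessLib

/-!
# `Ψ(log 2) > 0` — the first screw matrix `S_2 = [2Ψ(log 2)]` is positive definite, unconditionally

Suzuki2023 Thm 4.1 (J. Lond. Math. Soc. 108 = arXiv:2206.03682, §4.1) proves, with computer
assistance on the prime-free wall `[0, log 2]`, that `Ψ(t) > 0` for `0 < t < t₀` with some `t₀ > log 2`;
the tree vendors only its statement (`Suzuki2023_thm41`). This file proves the single value needed by
the nested screw matrices of route `IntegerScrew` (their `1 × 1` base `S_2 = [G(log 2, log 2)] =
[2Ψ(log 2)]`, pivot `d_2`): `0 < Ψ(log 2)` (`= 0.0635…`), by hand interval arithmetic from (1.1):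
at `t = log 2` the prime sum vanishes, `e^{±t/2} = √2^{±1}`, `Φ(e^{-2t},2,¼) = ∑ 4^{-k}(k+¼)^{-2}`, and
`Ψ(log 2) = 4(√2 + 1/√2 − 2) − (log 2/2)(γ₀ + π/2 + 3 log 2 + log π) + ¼ ∑_k (1 − 4^{-k}/√2)(k + ¼)^{-2}`
`≥ 0.48526 − 0.3465736·5.4627 + 5.709/4 > 0.019`, using Mathlib's `γ₀ < 2/3`, `π < 3.141593`,
`log 2 < 0.6931471808`, `log π < 1.1457` (from `e·(1 + x + x²/2) ≤ e^{1+x}`) and 20 terms of the series.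
-/

noncomputable section

open scoped BigOperators

namespace Literature.NumberTheory.LFunctions

/-- At `t = log 2` the prime sum of Suzuki2023 (1.1) vanishes: the only prime power `n ≤ e^{t} = 2` is
`n = 2`, entering with the factor `(t − log 2) = 0`. [cite: Suzuki2023, proof of Thm 4.1] -/
theorem zetaScrewPrimeSum_log_two : zetaScrewPrimeSum (Real.log 2) = 0 := by
  have hl2 : 0 < Real.log 2 := Real.log_pos one_lt_two
  unfold zetaScrewPrimeSum
  rw [abs_of_pos hl2, Real.exp_log two_pos]
  have hfl : ⌊(2 : ℝ)⌋₊ = 2 := by simp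
  rw [hfl, show Finset.Icc (1 : ℕ) 2 = {1, 2} from by decide, Finset.sum_pair (by norm_num)]
  simp

/-- `log π < 1.1457` (`π < 3.141593 < e · 1.1563 ≤ e · e^{0.1457}`). [folklore] -/
private theorem log_pi_lt_d4 : Real.log Real.pi < 1.1457 := by
  rw [Real.log_lt_iff_lt_exp Real.pi_pos]
  have h1 : (1.1563 : ℝ) ≤ Real.exp 0.1457 := by
    have := Real.quadratic_le_exp_of_nonneg (show (0 : ℝ) ≤ 0.1457 by norm_num)
    nlinarith
  have h2 : Real.exp (1.1457 : ℝ) = Real.exp 1 * Real.exp 0.1457 := by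
    rw [← Real.exp_add]; norm_num
  calc Real.pi < 3.141593 := Real.pi_lt_d6
    _ < 2.7182818283 * 1.1563 := by norm_num
    _ ≤ Real.exp 1 * Real.exp 0.1457 :=
        mul_le_mul Real.exp_one_gt_d9.le h1 (by norm_num) (Real.exp_pos 1).le
    _ = Real.exp 1.1457 := h2.symm

/-- The Hurwitz–Lerch value at `t = log 2`: `Φ(e^{-2 log 2}, 2, ¼) = ∑_k (1/4)^k (k + ¼)^{-2}`. [folklore] -/
private theorem hurwitzLerchQuarter_log_two :
    hurwitzLerchQuarter (Real.log 2) = ∑' k : ℕ, (1 / 4 : ℝ) ^ k / ((k : ℝ) + 1 / 4) ^ 2 := by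
  have hl2 : 0 < Real.log 2 := Real.log_pos one_lt_two
  unfold hurwitzLerchQuarter
  rw [abs_of_pos hl2]
  refine tsum_congr fun k => ?_
  congr 1
  rw [show -(2 * Real.log 2 * (k : ℝ)) = (k : ℝ) * (-(2 * Real.log 2)) by ring, Real.exp_nat_mul,
    Real.exp_neg, show (2 : ℝ) * Real.log 2 = ((2 : ℕ) : ℝ) * Real.log 2 by norm_num,
    Real.exp_nat_mul, Real.exp_log two_pos]
  norm_num

/-- **`Ψ(log 2) > 0`** (numerically `Ψ(log 2) = 0.06355…`): the diagonal entry `G(log 2, log 2) = 2Ψ(log 2)`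
of every screw Gram matrix on the integer nodes, i.e. the `1 × 1` matrix `S_2`, is positive —
unconditionally. A special value of Suzuki2023 Thm 4.1 (`Ψ > 0` on `(0, t₀)`, `t₀ > log 2`), proved here
by interval arithmetic with twenty terms of the Lerch series. [cite: Suzuki2023, Thm 4.1] -/
theorem zetaScrew_log_two_pos : 0 < zetaScrew (Real.log 2) := by
  have hl2 : 0 < Real.log 2 := Real.log_pos one_lt_two
  have habs : |Real.log 2| = Real.log 2 := abs_of_pos hl2
  rw [zetaScrew_eq, zetaScrewPrimeSum_log_two, hurwitzLerchQuarter_log_two, habs]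
  -- the archimedean quantities `a = e^{(log 2)/2} = √2`, `e^{-(log 2)/2} = a⁻¹ = a/2`
  set a : ℝ := Real.exp (Real.log 2 / 2) with ha
  have hb : Real.exp (-(Real.log 2 / 2)) = a⁻¹ := by rw [Real.exp_neg]
  rw [hb]
  have ha_pos : 0 < a := Real.exp_pos _
  have ha2 : a ^ 2 = 2 := by
    rw [sq, ha, ← Real.exp_add, show Real.log 2 / 2 + Real.log 2 / 2 = Real.log 2 by ring,
      Real.exp_log two_pos]
  have ha_lo : (1.41421 : ℝ) < a := by nlinarith
  have ha_hi : a < (1.41422 : ℝ) := by nlinarith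
  have hainv : a⁻¹ = a / 2 := by
    field_simp
    nlinarith
  rw [hainv]
  -- the series part: `∑ 1/(k+¼)² − (a/2) ∑ (1/4)^k/(k+¼)² = ∑ (1 − (a/2)(1/4)^k)/(k+¼)² ≥ 20 terms ≥ 5.709`
  have hs1 : Summable (fun k : ℕ => 1 / ((k : ℝ) + 1 / 4) ^ 2) := summable_one_div_nat_add_quarter_sq
  have hle : ∀ k : ℕ, (1 / 4 : ℝ) ^ k / ((k : ℝ) + 1 / 4) ^ 2 ≤ 1 / ((k : ℝ) + 1 / 4) ^ 2 := fun k =>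
    div_le_div_of_nonneg_right (pow_le_one₀ (by norm_num) (by norm_num)) (by positivity)
  have hs2 : Summable (fun k : ℕ => (1 / 4 : ℝ) ^ k / ((k : ℝ) + 1 / 4) ^ 2) :=
    hs1.of_nonneg_of_le (fun k => by positivity) hle
  have hT : (∑' k : ℕ, 1 / ((k : ℝ) + 1 / 4) ^ 2) - a / 2 * ∑' k : ℕ, (1 / 4 : ℝ) ^ k / ((k : ℝ) + 1 / 4) ^ 2
      = ∑' k : ℕ, (1 - a / 2 * (1 / 4 : ℝ) ^ k) / ((k : ℝ) + 1 / 4) ^ 2 := by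
    rw [← tsum_mul_left, ← (hs1).tsum_sub (hs2.mul_left _)]
    refine tsum_congr fun k => ?_
    ring
  have hs3 : Summable (fun k : ℕ => (1 - a / 2 * (1 / 4 : ℝ) ^ k) / ((k : ℝ) + 1 / 4) ^ 2) := by
    have := hs1.sub (hs2.mul_left (a / 2))
    refine this.congr fun k => ?_
    ring
  have hnonneg : ∀ k : ℕ, 0 ≤ (1 - a / 2 * (1 / 4 : ℝ) ^ k) / ((k : ℝ) + 1 / 4) ^ 2 := by
    intro k
    apply div_nonneg _ (by positivity)
    have hq : (1 / 4 : ℝ) ^ k ≤ 1 := pow_le_one₀ (by norm_num) (by norm_num)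
    have hq0 : 0 ≤ (1 / 4 : ℝ) ^ k := by positivity
    nlinarith
  have hpartial : ∑ k ∈ Finset.range 20, (1 - a / 2 * (1 / 4 : ℝ) ^ k) / ((k : ℝ) + 1 / 4) ^ 2 ≤
      ∑' k : ℕ, (1 - a / 2 * (1 / 4 : ℝ) ^ k) / ((k : ℝ) + 1 / 4) ^ 2 :=
    hs3.sum_le_tsum (Finset.range 20) (fun k _ => hnonneg k)
  -- termwise: `a/2 ≤ 0.70711`
  have hterm : ∀ k : ℕ, (1 - 0.70711 * (1 / 4 : ℝ) ^ k) / ((k : ℝ) + 1 / 4) ^ 2 ≤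
      (1 - a / 2 * (1 / 4 : ℝ) ^ k) / ((k : ℝ) + 1 / 4) ^ 2 := by
    intro k
    apply div_le_div_of_nonneg_right _ (by positivity)
    have hq0 : 0 ≤ (1 / 4 : ℝ) ^ k := by positivity
    nlinarith
  have hnum : (5.709 : ℝ) ≤ ∑ k ∈ Finset.range 20, (1 - 0.70711 * (1 / 4 : ℝ) ^ k) / ((k : ℝ) + 1 / 4) ^ 2 := by
    simp only [Finset.sum_range_succ, Finset.sum_range_zero]
    norm_num
  have hsum : (5.709 : ℝ) ≤ ∑' k : ℕ, (1 - a / 2 * (1 / 4 : ℝ) ^ k) / ((k : ℝ) + 1 / 4) ^ 2 :=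
    hnum.trans ((Finset.sum_le_sum fun k _ => hterm k).trans hpartial)
  rw [hT]
  -- the linear term
  have hγ := Real.eulerMascheroniConstant_lt_two_thirds
  have hγ0 : 0 < Real.eulerMascheroniConstant := by linarith [Real.one_half_lt_eulerMascheroniConstant]
  have hπ := Real.pi_lt_d6
  have hlog2 := Real.log_two_lt_d9
  have hlogπ := log_pi_lt_d4
  have hlogπ0 : 0 < Real.log Real.pi := Real.log_pos (by linarith [Real.pi_gt_three])
  have hκ : Real.eulerMascheroniConstant + Real.pi / 2 + 3 * Real.log 2 + Real.log Real.pi < 5.4627 := by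
    linarith
  have hκ0 : 0 ≤ Real.eulerMascheroniConstant + Real.pi / 2 + 3 * Real.log 2 + Real.log Real.pi := by
    positivity
  have hprod : Real.log 2 / 2 *
      (Real.eulerMascheroniConstant + Real.pi / 2 + 3 * Real.log 2 + Real.log Real.pi) ≤
      0.3465736 * 5.4627 :=
    mul_le_mul (by linarith) hκ.le hκ0 (by norm_num)
  nlinarith
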